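import Summits.BirchSwinnertonDyer.BirchSwinnertonDyer.Theorems.ResidualThetaTransportAtTwoResidualSignedLambdaLowerCMAtTwoLevelBracket
import Summits.BirchSwinnertonDyer.BirchSwinnertonDyer.Theorems.ResidualThetaTransportAtTwoAwayDefs
import HarnessLib

/-!
# GLUE clause (7), exponent bookkeeping: the SUPPLY exponent `Σ_g(S₀)` of RSL_g equals S1⊕'s away exponent `Σ_{S₀} 2^{nfl v}·(…)` for a CM newform

Route `ResidualThetaTransportAtTwo` (RTT), crux RSL_g `ResidualSignedLambdaLowerCMAtTwo` (stmt-BirchSwinnertonDyer-22608), line «onepair» (v3d), ASSEMBLY-SPEC-g19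
§1 row C7 (input `LevelBracket.sigma_eq_sum_good_of_cm hLV`). Seat `prover-bsd-wall-tp2-p2x-w2` g20 (`--supports`, closes nothing). THEOREMS ONLY.
BSD is not proved by any of this.

The crux's count (i) asks for `f·(d + Σ_g(S₀) + e)` with
`Σ_g(S₀) = ∑_{v ∈ S₀} 2^{v₂((ℓ_v² − 1)/8)} · (if ℓ_v ∣ M then [‖ι a_{ℓ_v} − 1‖ < 1] else 2·[‖ι a_{ℓ_v}‖ < 1])`, `ℓ_v = natGenerator v`, while the registered S1⊕
text (`stub_localDualAwayTwo`, p702453) delivers `f · ∑_{v ∈ S₀} 2^{nfl v} · (if ℓ_v ∣ M then 0 else 2·[‖ι a_{ℓ_v}‖ < 1]) ≤ λ(P_{S₀})`. For a CM newform on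
`Γ₀(M)` the two exponents AGREE: under LVsq every level prime divides `M` twice, so `a_ℓ = 0` (Atkin–Lehner) and the level bracket vanishes
(`LevelBracket.sigma_eq_sum_good_of_cm`); `nfl v` is `v₂((ℓ_v² − 1)/8)` by definition.
* **`OnePair.sigma_supply_eq_sigma_away`** — the equality of the two exponents (so C8 feeds `h1.2` to `OnePairPins.finite_and_count_span_locd_pins`
  with `σ :=` S1⊕'s sum and rewrites the conclusion into the SUPPLY exponent).

References: [AtkinLehner1970] Thm. 3; [Ribet1977Nebentypus] §3 Cor. (3.5), §4 Thm. (4.5) (LVsq); [Washington1997] §13.1 (`2^{n_w}` primes above `w`).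
-/

set_option autoImplicit false
-- the Theorems namespace of this sub repeats the summit name by design (D-0017 nested layout)
set_option linter.dupNamespace false

noncomputable section

open scoped MatrixGroups ModularForm
open CongruenceSubgroup NumberField IsDedekindDomain Rat.HeightOneSpectrum
  Literature.NumberTheory.EllipticCurves Literature.NumberTheory.EllipticCurves.ModularForms

namespace Summit.BirchSwinnertonDyer.BirchSwinnertonDyer.Theorems.OnePair

variable {M : ℕ} [NeZero M] {g : CuspForm (Gamma0 M) 2} (ι : coeffField g →+* PadicAlgCl 2)

/-- **The SUPPLY exponent of RSL_g is S1⊕'s away exponent, for a CM newform on `Γ₀(M)` (modulo the print fact LVsq).**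
`∑_{v ∈ S₀} 2^{v₂((ℓ_v²−1)/8)}·(if ℓ_v ∣ M then [‖ι a_{ℓ_v} − 1‖ < 1] else 2·[‖ι a_{ℓ_v}‖ < 1]) = ∑_{v ∈ S₀} 2^{nfl v}·(if ℓ_v ∣ M then 0 else 2·[‖ι a_{ℓ_v}‖ < 1])`,
`ℓ_v = natGenerator v`: the level brackets vanish (`LevelBracket.sigma_eq_sum_good_of_cm`) and `nfl v = v₂((ℓ_v²−1)/8)` by definition.
[cite: AtkinLehner1970, Thm. 3] [cite: Ribet1977Nebentypus, §4 Thm. (4.5) with §3 Cor. (3.5)] [cite: Washington1997, §13.1] -/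
theorem sigma_supply_eq_sigma_away (hLV : cmNewform_gamma0_sq_dvd_level) (S₀ : Finset (HeightOneSpectrum (𝓞 ℚ)))
    (hg : IsNewform0 g) (hcm : Literature.NumberTheory.Automorphic.IsCMForm (liftToGamma1 M 2 g)) :
    ∑ v ∈ S₀, 2 ^ padicValNat 2 ((natGenerator v ^ 2 - 1) / 8) *
        (if natGenerator v ∣ M then (if ‖embCoeff g ι (natGenerator v) - 1‖ < 1 then 1 else 0)
          else (if ‖embCoeff g ι (natGenerator v)‖ < 1 then 2 else 0)) =
      ∑ v ∈ S₀, 2 ^ nfl v * (if natGenerator v ∣ M then 0 else (if ‖embCoeff g ι (natGenerator v)‖ < 1 then 2 else 0)) := by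
  rw [LevelBracket.sigma_eq_sum_good_of_cm ι hLV S₀ natGenerator (fun v _ ↦ prime_natGenerator v) hg hcm, Finset.sum_filter]
  refine Finset.sum_congr rfl fun v _ ↦ ?_
  by_cases h : natGenerator v ∣ M
  · rw [if_neg (not_not.mpr h), if_pos h, mul_zero]
  · rw [if_pos h, if_neg h]
    rfl

/-- **The same as an inequality transport**: S1⊕'s bound `f · Σ_away ≤ λ` IS the bound `f · Σ_g(S₀) ≤ λ` the count (i) consumes. [cite: AtkinLehner1970, Thm. 3]
[cite: Ribet1977Nebentypus, §4 Thm. (4.5) with §3 Cor. (3.5)] -/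
theorem mul_sigma_supply_le_of_away (hLV : cmNewform_gamma0_sq_dvd_level) (S₀ : Finset (HeightOneSpectrum (𝓞 ℚ)))
    (hg : IsNewform0 g) (hcm : Literature.NumberTheory.Automorphic.IsCMForm (liftToGamma1 M 2 g)) {f lam : ℕ}
    (h : f * ∑ v ∈ S₀, 2 ^ nfl v * (if natGenerator v ∣ M then 0 else (if ‖embCoeff g ι (natGenerator v)‖ < 1 then 2 else 0)) ≤ lam) :
    f * ∑ v ∈ S₀, 2 ^ padicValNat 2 ((natGenerator v ^ 2 - 1) / 8) *
        (if natGenerator v ∣ M then (if ‖embCoeff g ι (natGenerator v) - 1‖ < 1 then 1 else 0)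
          else (if ‖embCoeff g ι (natGenerator v)‖ < 1 then 2 else 0)) ≤ lam := by
  rwa [sigma_supply_eq_sigma_away ι hLV S₀ hg hcm]

end Summit.BirchSwinnertonDyer.BirchSwinnertonDyer.Theorems.OnePair

end
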